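import Mathlib.NumberTheory.NumberField.CMField
import Literature.NumberTheory.Automorphic.AdeleBaseChange
import Literature.NumberTheory.GaloisRepresentations.GaloisRep
import Literature.NumberTheory.NumberFields.SolubleCMExtensionAssembly
import HarnessLib

/-!
# Clozel–Harris–Taylor 2008, Lemma 4.1.2 (CM form): soluble Galois CM extensions with prescribed local
# behaviour, linearly disjoint from a given finite extension

Topic `NumberTheory/NumberFields` (pattern of `ConjugationSolvable.lean` and of the soluble base change / descent facts
`ACC2023.solubleBaseChange_isAutomorphic` / `solubleDescent_isAutomorphic`: `IsGalois F L`, `IsSolvable (L ≃ₐ[F] L)`,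
`NumberField.IsCMField`; linear disjointness as `IsField (D ⊗[F] L)` as in `Qian2022.potentialAutomorphy_ordinary`; the
local base-change map `adicCompletionOfLiesOver F L v w : F_v →+* L_w` of `AdeleBaseChange` and the restriction of absolute
Galois groups `absGaloisRestrict` of `GaloisRep`).  Requested by the line `thorne-minimal-lift` of crux `stmt-Langlands-13757`
(blueprint fact F1 of its stub `stub_pointAutomorphic`: the soluble CM base change `L/F'` over which the point of the ordinary
family, its companion and the twisting character become unramified away from `3` and crystalline above `3`, so that the
minimal case of Thorne 2017 Thm 5.1 — tree `Thorne2017.automorphyLifting_unitary_ordinaryMinimal` — applies, and from which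
`ACC2023.solubleDescent_isAutomorphic` descends).

L. Clozel, M. Harris, R. Taylor, *Automorphy for some l-adic lifts of automorphic mod l Galois representations*, Publ.
Math. IHÉS 108 (2008) 1–181 (held text `paper:doi-10-1007-s10240-008-0016-1`, read 2026-08-17), **Lemma 4.1.2**
(p. 116), as printed:

> Suppose that `F` is a number field, `D/F` is a finite Galois extension and `S` is a finite set of places of `F`. For
> `v ∈ S` let `E_v/F_v` be a finite Galois extension. Then we can find a finite, soluble Galois extension `E/F` linearly
> disjoint from `D` such that for each `v ∈ S` and each prime `w` of `E` above `v`, the extension `E_w/F_v` is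
> isomorphic to `E_v/F_v`.

and its use for CM fields in the same paper (proof of Thm. 4.4.2, pp. 130–131 of the journal: "Choose a CM field `L/F`
with the following properties: `L = L⁺E` …; `L/F` is Galois and soluble; `L` is linearly disjoint from `F̄^{ker r̄}(ζ_l)`
over `F`; … if `v` is a place of `L` above `R` then `r|_{Gal(L̄/L)}` is unramified at `v`"), cf. Barnet-Lamb–Gee–
Geraghty–Taylor 2014 §3.3 (arXiv:1010.2561 p. 28: "Choose a finite, soluble, Galois, CM extension `F₁/F` which is
linearly disjoint from … such that for all `u` lying above `S` we have `r̄(G_{F₁,u}) = {1}`; for all `u ∣ l` …").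

## What is vendored: the CM form, with the local condition as CONTAINMENT IN A GIVEN OPEN SUBGROUP

NAMED FACT (D-0014) `ClozelHarrisTaylor2008.exists_solvable_cm_extension_local`: for a CM number field `F`, a finite
extension `D/F`, a finite set `S` of finite places of `F` and open subgroups `U_v ≤ Γ_{F_v}`: there is a finite soluble
Galois CM extension `L/F`, linearly disjoint from `D` over `F` (`D ⊗_F L` is a field), such that for every `v ∈ S` and
every place `w ∣ v` of `L` the image of `Γ_{L_w} → Γ_{F_v}` (restriction along the local base change `F_v → L_w`) lies
in `U_v`.  This is the printed lemma applied over `F⁺` — to `S⁺ =` the places below `S` together with ALL infinite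
places, `E_{v⁺} :=` a finite Galois extension of `F⁺_{v⁺}` containing the fixed fields of the normal cores of the `U_v`
(`v ∣ v⁺`), `E_{v⁺} = ℝ` at the infinite places (so that `E⁺` is totally real), and `D⁺ :=` the Galois closure of `D`
over `F⁺` — followed by `L := E⁺ · F` (CM; `Gal(L/F) ≅ Gal(E⁺/F⁺)` soluble; linearly disjoint from `D` over `F`; and
`Γ_{L_w} ⊆ Γ_{E_{v⁺}} ⊆ core(U_v) ⊆ U_v`, a normal subgroup, so the containment does not depend on the embeddings behind
`absGaloisRestrict`).  Weaker than print in that only containment (not the isomorphism type of `L_w/F_v`) is recorded;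
the Galois hypothesis on `D` is dropped by passing to a Galois closure.
-- TODO(general form): arbitrary number field `F` and prescribed isomorphism type `L_w/F_v ≅ E_v/F_v` (p. 116 verbatim);
-- archimedean places in `S`.

## References

* [ClozelHarrisTaylor2008] L. Clozel, M. Harris, R. Taylor, Publ. Math. IHÉS 108 (2008), Lemma 4.1.1, Lemma 4.1.2
  (p. 116), proof of Thm. 4.4.2 (pp. 130–131).
* [BarnetlambEtAl2014] T. Barnet-Lamb, T. Gee, D. Geraghty, R. Taylor, Ann. of Math. 179 (2014), §3.3
  (arXiv:1010.2561 p. 28).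
-/

noncomputable section

open scoped NumberField TensorProduct
open NumberField IsDedekindDomain Field
open Literature.NumberTheory.GaloisRepresentations Literature.NumberTheory.Automorphic

namespace Literature.NumberTheory.NumberFields

namespace ClozelHarrisTaylor2008

/-- **CHT 2008, Lemma 4.1.2 — CM form: soluble Galois CM extensions, linearly disjoint from a given finite extension,
with prescribed local containment**, NAMED FACT.  For every CM number field `F`, finite extension `D/F`, finite set `S`
of finite places of `F` and family of open subgroups `U v ≤ Γ_{F_v}`, there is a number field `L ⊇ F`, Galois over `F`
with soluble Galois group, CM, with `D ⊗_F L` a field, such that for all `v ∈ S` and all places `w` of `L` above `v`,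
every element of `Γ_{L_w}` restricts into `U v` along the local base-change map `F_v → L_w`
(`adicCompletionOfLiesOver`).  Printed lemma and its CM application quoted in the module docstring.
[cite: ClozelHarrisTaylor2008, Lemma 4.1.2 (p. 116) and proof of Thm. 4.4.2 (pp. 130–131)]
[cite: BarnetlambEtAl2014, §3.3 (arXiv p. 28)] -/
def exists_solvable_cm_extension_local : Prop :=
  ∀ (F : Type) [Field F] [NumberField F], NumberField.IsCMField F →
    ∀ (D : Type) [Field D] [Algebra F D], FiniteDimensional F D →
    ∀ (S : Finset (HeightOneSpectrum (𝓞 F)))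
      (U : (v : HeightOneSpectrum (𝓞 F)) → OpenSubgroup (absoluteGaloisGroup (v.adicCompletion F))),
    ∃ (L : Type) (_ : Field L) (_ : NumberField L) (_ : Algebra F L),
      IsGalois F L ∧ IsSolvable (L ≃ₐ[F] L) ∧ NumberField.IsCMField L ∧ IsField (D ⊗[F] L) ∧
      ∀ v ∈ S, ∀ (w : HeightOneSpectrum (𝓞 L)) (_ : w.asIdeal.LiesOver v.asIdeal),
        letI := (adicCompletionOfLiesOver F L v w).toAlgebra
        ∀ τ : absoluteGaloisGroup (w.adicCompletion L),
          absGaloisRestrict (v.adicCompletion F) (w.adicCompletion L) τ ∈ U v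

/-- **Discharge of the named fact** `exists_solvable_cm_extension_local` (CHT 2008, Lemma 4.1.2, CM
form with local containment).  Proved WITHOUT class field theory: over the maximal totally real
subfield `F⁺` one builds a totally real solvable Galois extension `E/F⁺` by a tower of Hecke–Kummer
cyclic layers of prime degree with prescribed completions (`SolvableTowerEngine`,
`KummerLayerRound`), and takes `L = E · F` (`SolubleCMExtensionAssembly`): `L/F` is Galois with
solvable group, CM, linearly disjoint from `D` (Chebotarev places force `E F ∩ D̃ = F`), and the
local groups of `L` restrict into the given open subgroups.
[cite: ClozelHarrisTaylor2008, Lemma 4.1.2 (p. 116) and proof of Thm. 4.4.2 (pp. 130–131)] -/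
theorem exists_solvable_cm_extension_local_holds : exists_solvable_cm_extension_local :=
  fun F _ _ hCM D _ _ hD S U => exists_solvable_cm_extension_local_of F hCM D hD S U

end ClozelHarrisTaylor2008

end Literature.NumberTheory.NumberFields

end
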